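import Mathlib.Analysis.Calculus.Deriv.MeanValue
import Summits.QuantumFields.YangMills.Theorems.BalabanUVNodesN21GaussianSupDensityBoundHetero

/-!
# N21 (NE7c) · the HAZARD-RATE PRINCIPLE behind `√(2 log n)`: the density of a maximum of independent variables never
# exceeds the largest hazard rate of its components — uniformly in their number

R134 seat pub-ymgap-dag-n21-d (typed g7, filed g8), node N21 = NE7c (single-run shell-weight bound, NOT PRINTED in [Bałaban 1983–89],
NOT proved), lane K3⁷ `SpineGivenEndpointR13SepCoPH` (stmt-QuantumFields-20544, `--kind proof --supports … --as helper`).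
Part 6 of the comparison-model series; it abstracts the mechanism of parts 2–3 (`maxDensity_le`, `maxDensityHetero_le`).

WHAT THIS FILE IS.  For INDEPENDENT real variables with distribution functions `F_i` and densities `f_i = F_i′`, the
distribution function of the maximum is `∏_i F_i` with density `Σ_i f_i ∏_{k≠i} F_k`.  If every component obeys a
HAZARD-RATE bound at the point `z`, `f_i(z) ≤ h·(1 − F_i(z))`, then — by the «exactly one exceeds» inequality of part 3
(`Σ_i (1 − F_i)∏_{k≠i} F_k ≤ 1`) — the density of the maximum at `z` is `≤ h`, WHATEVER THE NUMBER `n` of variables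
(§1–§2).  The only place where `n` enters is the region where the hazard bound is poor (small `z`), and there the crude
bound `Σ_i f_i(z)` takes over (§2 `deriv_finsetProd_le_sum`); §3 packages the two as a Lipschitz bound of `∏ F_i` by
the mean value theorem.  For standard Gaussians the hazard rate at `z ≥ 1` is `≤ z + 1` (part 1's Gordon bound) and
`Σ_i f_i ≤ 1∕√(2π)` beyond `√(2 log n)` — this is exactly how `√(2 log n) + 4` arose.  READING FOR THE WALL (lens Card 36
∕ KT-36a): on a road with independence-type structure across tested plaquettes, (M1) for the block-sup needs NO Gaussian
comparison — only a ONE-DIMENSIONAL hazard-rate bound for the single tested variable near the threshold, a quantity of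
large-deviation type.

HONEST FRAMING.  [textbook] real analysis (hazard rates of maxima), 0 def, 0 sorry; nothing of Bałaban's asserted; the
independence structure is the model's assumption, not a property of the (2.18) fibre law; NE7c NOT PRINTED ∕ NOT proved;
N21 NOT discharged; counts unmoved (typed 28∕28 · discharged 5∕27); count-neutral; one finite 𝕋⁴ at fixed ε — nothing
about ℝ⁴ ∕ OS ∕ mass gap ∕ Clay.
-/

open Set Finset

namespace Summit.QuantumFields.YangMills.Theorems.N21MaxHazardRate

open Summit.QuantumFields.YangMills.Theorems.N21GaussianSupDensityBoundHetero (sum_one_sub_mul_prod_erase_le_one)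

/-! ## §1 The algebraic core: a common hazard bound passes to the maximum, uniformly in the number of variables -/

/-- **HAZARD-RATE PRINCIPLE (numbers).**  `t_i ∈ [0,1]`, `0 ≤ f_i ≤ h·(1 − t_i)` for `i ∈ s` ⇒
`Σ_{i∈s} (∏_{k∈s∖i} t_k)·f_i ≤ h` — independently of `s.card`. [textbook] -/
theorem sum_prod_erase_mul_le_of_hazard {ι : Type*} [DecidableEq ι] (s : Finset ι) (t f : ι → ℝ) {h : ℝ}
    (hh : 0 ≤ h) (h0 : ∀ i ∈ s, 0 ≤ t i) (h1 : ∀ i ∈ s, t i ≤ 1)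
    (hhaz : ∀ i ∈ s, f i ≤ h * (1 - t i)) :
    ∑ i ∈ s, (∏ k ∈ s.erase i, t k) * f i ≤ h := by
  have hprod0 : ∀ i ∈ s, 0 ≤ ∏ k ∈ s.erase i, t k := fun i _ =>
    prod_nonneg fun k hk => h0 k (mem_of_mem_erase hk)
  calc ∑ i ∈ s, (∏ k ∈ s.erase i, t k) * f i
      ≤ ∑ i ∈ s, (∏ k ∈ s.erase i, t k) * (h * (1 - t i)) :=
        sum_le_sum fun i hi => mul_le_mul_of_nonneg_left (hhaz i hi) (hprod0 i hi)
    _ = h * ∑ i ∈ s, (1 - t i) * ∏ k ∈ s.erase i, t k := by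
        rw [mul_sum]
        exact sum_congr rfl fun i _ => by ring
    _ ≤ h * 1 := mul_le_mul_of_nonneg_left (sum_one_sub_mul_prod_erase_le_one s t h0 h1) hh
    _ = h := mul_one h

/-- the crude bound: `t_i ∈ [0,1]`, `0 ≤ f_i` ⇒ `Σ_{i∈s} (∏_{k∈s∖i} t_k)·f_i ≤ Σ_{i∈s} f_i`. [textbook] -/
theorem sum_prod_erase_mul_le_sum {ι : Type*} [DecidableEq ι] (s : Finset ι) (t f : ι → ℝ)
    (h0 : ∀ i ∈ s, 0 ≤ t i) (h1 : ∀ i ∈ s, t i ≤ 1) (hf : ∀ i ∈ s, 0 ≤ f i) :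
    ∑ i ∈ s, (∏ k ∈ s.erase i, t k) * f i ≤ ∑ i ∈ s, f i := by
  refine sum_le_sum fun i hi => ?_
  have hle : ∏ k ∈ s.erase i, t k ≤ 1 :=
    prod_le_one (fun k hk => h0 k (mem_of_mem_erase hk)) (fun k hk => h1 k (mem_of_mem_erase hk))
  have h0' : 0 ≤ ∏ k ∈ s.erase i, t k := prod_nonneg fun k hk => h0 k (mem_of_mem_erase hk)
  nlinarith [hf i hi]

/-! ## §2 The derivative of `∏_i F_i` under a pointwise hazard bound -/

section Deriv

variable {ι : Type*} [DecidableEq ι] (s : Finset ι) (F : ι → ℝ → ℝ) (f : ι → ℝ → ℝ)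

/-- the distribution function of the maximum, `z ↦ ∏_{i∈s} F_i(z)`, has derivative `Σ_i (∏_{k≠i} F_k(z))·f_i(z)`
(`HasDerivAt.fun_finsetProd`). [textbook] -/
theorem hasDerivAt_finsetProd (z : ℝ) (hF : ∀ i ∈ s, HasDerivAt (F i) (f i z) z) :
    HasDerivAt (fun x => ∏ i ∈ s, F i x) (∑ i ∈ s, (∏ k ∈ s.erase i, F k z) • f i z) z :=
  HasDerivAt.fun_finsetProd hF

/-- **THE DENSITY OF THE MAXIMUM IS AT MOST THE COMMON HAZARD BOUND** at every point where one holds: if each `F_i` is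
differentiable at `z` with `0 ≤ F_i(z) ≤ 1` and `F_i′(z) ≤ h·(1 − F_i(z))`, then `(∏_i F_i)′(z) ≤ h` — for every number of
variables. [textbook] -/
theorem deriv_finsetProd_le_of_hazard (z : ℝ) {h : ℝ} (hh : 0 ≤ h) (hF : ∀ i ∈ s, HasDerivAt (F i) (f i z) z)
    (h0 : ∀ i ∈ s, 0 ≤ F i z) (h1 : ∀ i ∈ s, F i z ≤ 1) (hhaz : ∀ i ∈ s, f i z ≤ h * (1 - F i z)) :
    deriv (fun x => ∏ i ∈ s, F i x) z ≤ h := by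
  rw [(hasDerivAt_finsetProd s F f z hF).deriv]
  simp only [smul_eq_mul]
  exact sum_prod_erase_mul_le_of_hazard s (fun k => F k z) (fun i => f i z) hh h0 h1 hhaz

/-- the crude bound at a point: `(∏_i F_i)′(z) ≤ Σ_i F_i′(z)` (`0 ≤ F_i(z) ≤ 1`, `0 ≤ F_i′(z)`). [textbook] -/
theorem deriv_finsetProd_le_sum (z : ℝ) (hF : ∀ i ∈ s, HasDerivAt (F i) (f i z) z)
    (h0 : ∀ i ∈ s, 0 ≤ F i z) (h1 : ∀ i ∈ s, F i z ≤ 1) (hf : ∀ i ∈ s, 0 ≤ f i z) :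
    deriv (fun x => ∏ i ∈ s, F i x) z ≤ ∑ i ∈ s, f i z := by
  rw [(hasDerivAt_finsetProd s F f z hF).deriv]
  simp only [smul_eq_mul]
  exact sum_prod_erase_mul_le_sum s (fun k => F k z) (fun i => f i z) h0 h1 hf

/-! ## §3 The Lipschitz bound of the distribution function of the maximum -/

/-- **LIPSCHITZ BOUND OF `∏ F_i` FROM A TWO-REGIME POINTWISE BOUND.**  If the `F_i` are differentiable everywhere with
`0 ≤ F_i ≤ 1`, `0 ≤ F_i′`, and at EVERY point either the common hazard bound `F_i′(z) ≤ h(z)(1 − F_i(z))` with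
`h(z) ≤ S` holds for all `i`, or the crude bound `Σ_i F_i′(z) ≤ S` holds, then `∏ F_i(b) − ∏ F_i(a) ≤ S·(b − a)` for
`a ≤ b` (mean value theorem) — the abstract form of parts 2–3's `cdf_pow_sub_le` ∕ `prod_cdf_sub_le`, with `S`
independent of the number of variables wherever the hazard regime applies. [textbook] -/
theorem prod_sub_prod_le_of_hazard_or_sum {S : ℝ} (hF : ∀ z, ∀ i ∈ s, HasDerivAt (F i) (f i z) z)
    (h0 : ∀ z, ∀ i ∈ s, 0 ≤ F i z) (h1 : ∀ z, ∀ i ∈ s, F i z ≤ 1) (hf : ∀ z, ∀ i ∈ s, 0 ≤ f i z)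
    (hreg : ∀ z, (∃ h : ℝ, 0 ≤ h ∧ h ≤ S ∧ ∀ i ∈ s, f i z ≤ h * (1 - F i z)) ∨ ∑ i ∈ s, f i z ≤ S)
    {a b : ℝ} (hab : a ≤ b) :
    ∏ i ∈ s, F i b - ∏ i ∈ s, F i a ≤ S * (b - a) := by
  have hdiff : Differentiable ℝ fun x => ∏ i ∈ s, F i x :=
    fun z => (hasDerivAt_finsetProd s F f z (hF z)).differentiableAt
  have hbound : ∀ z, deriv (fun x => ∏ i ∈ s, F i x) z ≤ S := by
    intro z
    rcases hreg z with ⟨h, hh, hhS, hhaz⟩ | hsum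
    · exact (deriv_finsetProd_le_of_hazard s F f z hh (hF z) (h0 z) (h1 z) hhaz).trans hhS
    · exact (deriv_finsetProd_le_sum s F f z (hF z) (h0 z) (h1 z) (hf z)).trans hsum
  exact image_sub_le_mul_sub_of_deriv_le hdiff hbound hab

end Deriv

/-! ## §4 The Gaussian hazard rate (part 1 ∕ part 3 by name): the two regimes behind `√(2 log n) + 4` -/

open ProbabilityTheory
open Summit.QuantumFields.YangMills.Theorems.N21GaussianMillsRatio
open Summit.QuantumFields.YangMills.Theorems.N21GaussianSupDensityBoundHetero (gaussianPDFReal_le_posPart_add_four_mul_tail)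

-- the standard normal HAZARD RATE is at most `max(z, 0) + 4` everywhere: part 3's
-- `gaussianPDFReal_le_posPart_add_four_mul_tail` (CITED below as the hypothesis shape `hhaz` of §2 with `F = Φ`, `f = φ`).

/-- for ANY finite family of standard Gaussian distribution functions and any point `z ≤ z₁` (`0 ≤ z₁`), the density of
the maximum at `z` is at most `z₁ + 4` — no dependence on the number of variables (§2 at `h := max z 0 + 4`, the Gaussian
hazard bound being part 3's `gaussianPDFReal_le_posPart_add_four_mul_tail`, cited). [textbook] -/
theorem deriv_prod_cdf_std_le {ι : Type*} [DecidableEq ι] (s : Finset ι) {z z₁ : ℝ} (hz₁ : 0 ≤ z₁) (hz : z ≤ z₁) :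
    deriv (fun x => ∏ _i ∈ s, cdf (gaussianReal 0 1) x) z ≤ z₁ + 4 := by
  have hmax : max z 0 ≤ z₁ := max_le hz hz₁
  refine (deriv_finsetProd_le_of_hazard s (fun _ => fun x => cdf (gaussianReal 0 1) x) (fun _ => gaussianPDFReal 0 1) z
    (h := max z 0 + 4) (by positivity) (fun _ _ => hasDerivAt_cdf_std z) (fun _ _ => cdf_nonneg _ _)
    (fun _ _ => cdf_le_one _ _) (fun _ _ => gaussianPDFReal_le_posPart_add_four_mul_tail z)).trans ?_
  linarith

end Summit.QuantumFields.YangMills.Theorems.N21MaxHazardRate
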